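import Summits.HodgeConjecture.HodgeConjecture.Theorems.PadicSemiregularLiftHodgeFermatVarietiesLatticeCriterion
import Summits.HodgeConjecture.HodgeConjecture.Theorems.PadicSemiregularLiftHodgeFermatVarietiesPrintedSupply
import Summits.HodgeConjecture.HodgeConjecture.Theorems.PadicSemiregularLiftHodgeFermatVarietiesLevelRaise
import Literature.AlgebraicGeometry.HodgeTheory.FermatClaimConjugation
import HarnessLib

/-!
# One algebraic representative per coset suffices: stub `stub_claimOfCosetRepresentative` of line `cancel-by-any-claim-lattice`

Route `PadicSemiregularLift` of `HodgeConjecture`, crux `HodgeFermatVarieties`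
(stmt-HodgeConjecture-1334: the Hodge conjecture for every complex Fermat hypersurface
`Xⁿₘ : Σ xᵢᵐ = 0 ⊂ ℙⁿ⁺¹`). The line organises Aoki's claim(α) by ℤ-REACHABILITY of the multiset of
values of a Hodge character `α` from the printed supply (pairs `{a, −a}`, Hodge quadruples,
semi-decomposable Hodge multisets, standard elements `σ_{p,a}`). In every computed degree the
residual (unreached) Hodge multisets form, per bad degree, ONE `ℤ/2`-coset of the Hodge lattice
modulo the stable span of the supply; this file turns "one algebraic representative per coset
suffices" into a theorem:

**Coset representative.** Granted the five named facts of S0 (Aoki 1987 Thm 1-4 (i), (ii); Shioda's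
paired claim; Aoki–Shioda 1983; Aoki 1987 Thm 2-1) and the STATEMENTS of the stubs S2↑, S2↓ (claim is
invariant under level raising `a ↦ k⟨a⟩` of zero-free characters) and S3a (semi-decomposable Hodge
multisets are claimed) — all taken as ANTECEDENTS, nothing is assumed — let `s, r ≠ 0` be Hodge
multisets of level `m` and `k ≥ 1`. If the raised copies differ by supply elements of level `km`,
`k•s + ΣN = k•r + ΣP` with finite families `P, N ⊆ Supply[km]`, and `r` is claimed, then `s` is
claimed.

Proof: raise to level `km`. By S2↑ (`claimMultiset_levelRaise_iff_of_pull_push`, landed) `k•r` is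
claimed; it is a non-empty Hodge multiset (`isHodgeMultiset_levelRaise`, landed), and its negation is
claimed (`ClaimMultiset.map_neg`). Hence the family `D := Supply[km] ∪ {k•r}` consists of non-empty
Hodge multisets each claimed with its negation (the supply part is the landed S3b,
`stub_printedSupply`), and `k•s + ΣN = Σ(k•r :: P)` exhibits `k•s` as ℤ-reachable from `D`; the
landed lattice criterion S1 (`stub_latticeCriterion`) gives claim(`k•s`), and S2↓ brings it back to
level `m`.

References: [Aoki1987] N. Aoki, Some new algebraic cycles on Fermat varieties, J. Math. Soc. Japan
39 (1987) 385–396, Thm 1-4 (p. 388), Thm 2-1; [Shioda1979PJA] T. Shioda, Proc. Japan Acad. 55A (1979)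
111–114, §1 (the semigroup `Mₘ`).
-/

set_option linter.dupNamespace false

noncomputable section

open Finset
open Literature.AlgebraicGeometry.HodgeTheory Literature.AlgebraicGeometry.HodgeTheory.FermatCharacter

namespace Summit.HodgeConjecture.HodgeConjecture.Theorems.CancelByAnyClaimLattice.CosetRepresentative

/-- `Supply[M]` — the printed supply of level `M` (local notation of the line, verbatim). -/
local notation3 (prettyPrint := false) "Supply[" M "]" =>
  ({s : Multiset (ZMod M) | ∃ a : ZMod M, a ≠ 0 ∧ s = ({a, -a} : Multiset (ZMod M))} ∪
    {s : Multiset (ZMod M) | IsHodgeMultiset s ∧ Multiset.card s = 4} ∪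
    {s : Multiset (ZMod M) | IsHodgeMultiset s ∧ IsSemiDecomposable s} ∪
    {s : Multiset (ZMod M) | ∃ (p : ℕ) (a : ZMod M), p.Prime ∧ p ≠ 2 ∧ p ∣ M ∧
        2 < (M / p) / Nat.gcd (ZMod.val a) (M / p) ∧
        s = Multiset.map (fun j : ℕ => a + (j : ZMod M) * ((M / p : ℕ) : ZMod M)) (Multiset.range p) +
              {-((p : ZMod M) * a)}} : Set (Multiset (ZMod M)))

/-- `Reach[M, s]` (local notation of the line, verbatim). -/
local notation3 (prettyPrint := false) "Reach[" M ", " s "]" =>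
  ∃ P N : Multiset (Multiset (ZMod M)),
    (∀ u ∈ P, u ∈ Supply[M]) ∧ (∀ u ∈ N, u ∈ Supply[M]) ∧ s + Multiset.sum N = Multiset.sum P

/-- `LevelRaise[k, m, s]` (local notation of the line, verbatim). -/
local notation3 (prettyPrint := false) "LevelRaise[" k ", " m ", " s "]" =>
  Multiset.map (fun a : ZMod m => ((k * ZMod.val a : ℕ) : ZMod (k * m))) s

/-- `StableReach[m, s]` (local notation of the line, verbatim). -/
local notation3 (prettyPrint := false) "StableReach[" m ", " s "]" => ∃ k : ℕ, 0 < k ∧ Reach[k * m, LevelRaise[k, m, s]]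

/-- **Stub `stub_claimOfCosetRepresentative` — one algebraic representative per coset suffices.**
Granted the five named facts of S0 and the statements of S2↑, S2↓, S3a as antecedents: if `s, r ≠ 0`
are Hodge multisets of level `m`, `k ≥ 1`, the raised copies satisfy `k•s + ΣN = k•r + ΣP` for finite
families `P, N ⊆ Supply[km]`, and `r` is claimed, then `s` is claimed. Proof: `k•r` is a non-empty
claimed Hodge multiset of level `km` whose negation is claimed, so `D := Supply[km] ∪ {k•r}` is a
family of non-empty Hodge multisets each claimed with its negation (landed S3b `stub_printedSupply`);
`k•s + ΣN = Σ(k•r :: P)` and the landed lattice criterion S1 (`stub_latticeCriterion`) give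
claim(`k•s`), and S2↓ (`claimMultiset_levelRaise_iff_of_pull_push`) descends to level `m`.
[cite: Aoki1987, Thm. 1-4 (i) and (ii), p. 388] [cite: Shioda1979PJA, §1 (the semigroup Mₘ)] -/
theorem stub_claimOfCosetRepresentative :
    Aoki1987_claim_juxtaposition → Aoki1987_claim_of_claim_juxtaposition_paired → Shioda_claim_paired →
    AokiShioda1983_eigenline_le_neronSeveri → Aoki1987_claim_pStandard →
    (∀ (m k r : ℕ) (α' : Fin (2 * r + 2) → ZMod m), 0 < k → (∀ i, α' i ≠ 0) → FermatCharacter.Claim m r α' →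
      FermatCharacter.Claim (k * m) r (fun i => ((k * (α' i).val : ℕ) : ZMod (k * m)))) →
    (∀ (m k r : ℕ) (α' : Fin (2 * r + 2) → ZMod m), 0 < k → (∀ i, α' i ≠ 0) →
      FermatCharacter.Claim (k * m) r (fun i => ((k * (α' i).val : ℕ) : ZMod (k * m))) → FermatCharacter.Claim m r α') →
    (∀ (M : ℕ) [NeZero M] (s : Multiset (ZMod M)), IsHodgeMultiset s → IsSemiDecomposable s → ClaimMultiset M s) →
    ∀ (m k : ℕ) [NeZero m] (s r : Multiset (ZMod m)), 0 < k → s ≠ 0 → IsHodgeMultiset s → r ≠ 0 → IsHodgeMultiset r →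
      ClaimMultiset m r →
      (∃ P N : Multiset (Multiset (ZMod (k * m))), (∀ u ∈ P, u ∈ Supply[k * m]) ∧ (∀ u ∈ N, u ∈ Supply[k * m]) ∧
        LevelRaise[k, m, s] + N.sum = LevelRaise[k, m, r] + P.sum) →
      ClaimMultiset m s := by
  rintro hJ hC hP hNS hS hPull hPush h3a m k _ s r hk hs0 hs hr0 hr hcr ⟨P, N, hPm, hNm, hEq⟩
  haveI : NeZero (k * m) := ⟨Nat.mul_ne_zero hk.ne' (NeZero.ne m)⟩
  -- S2 (a)+(b): level raising preserves Hodge-ness and (granted S2↑, S2↓) claim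
  have h2 : ∀ (m k : ℕ) [NeZero m], 0 < k → ∀ s : Multiset (ZMod m), s ≠ 0 → IsHodgeMultiset s →
      IsHodgeMultiset (LevelRaise[k, m, s]) ∧ (ClaimMultiset m s ↔ ClaimMultiset (k * m) (LevelRaise[k, m, s])) :=
    fun m k _ hk s hs0 hs ↦ ⟨isHodgeMultiset_levelRaise m k hk s hs0 hs,
      claimMultiset_levelRaise_iff_of_pull_push hPull hPush m k hk s hs0 hs⟩
  -- the raised representative `k•r`: non-empty, Hodge, claimed, with claimed negation
  have hkr : ClaimMultiset (k * m) (LevelRaise[k, m, r]) :=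
    (claimMultiset_levelRaise_iff_of_pull_push hPull hPush m k hk r hr0 hr).1 hcr
  have hkrH : IsHodgeMultiset (LevelRaise[k, m, r]) := isHodgeMultiset_levelRaise m k hk r hr0 hr
  have hkr0 : LevelRaise[k, m, r] ≠ 0 := fun h ↦ hr0 (Multiset.map_eq_zero.1 h)
  -- the raised target `k•s`: non-empty and Hodge
  have hksH : IsHodgeMultiset (LevelRaise[k, m, s]) := isHodgeMultiset_levelRaise m k hk s hs0 hs
  have hks0 : LevelRaise[k, m, s] ≠ 0 := fun h ↦ hs0 (Multiset.map_eq_zero.1 h)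
  -- the claimed family `D := Supply[km] ∪ {k•r}`
  have hD : ∀ x ∈ (Supply[k * m] ∪ {x : Multiset (ZMod (k * m)) | x = LevelRaise[k, m, r]}),
      x ≠ 0 ∧ IsHodgeMultiset x ∧ ClaimMultiset (k * m) x ∧ ClaimMultiset (k * m) (x.map fun a ↦ -a) := by
    intro x hx
    rcases hx with hx | hx
    · exact stub_printedSupply hP hNS hS h3a h2 (k * m) x hx
    · rw [Set.mem_setOf_eq] at hx
      subst hx
      exact ⟨hkr0, hkrH, hkr, hkr.map_neg⟩
  -- ℤ-reachability of `k•s` from `D`: `k•s + ΣN = Σ(k•r :: P)`, so S1 gives claim(`k•s`)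
  have hks : ClaimMultiset (k * m) (LevelRaise[k, m, s]) := by
    refine stub_latticeCriterion hJ hC (k * m) _ hD (LevelRaise[k, m, s]) (LevelRaise[k, m, r] ::ₘ P) N
      hks0 hksH ?_ ?_ ?_
    · intro u hu
      rcases Multiset.mem_cons.1 hu with rfl | hu
      · exact Or.inr rfl
      · exact Or.inl (hPm u hu)
    · exact fun u hu ↦ Or.inl (hNm u hu)
    · rw [Multiset.sum_cons, hEq]
  -- descend to level `m` by S2↓
  exact (claimMultiset_levelRaise_iff_of_pull_push hPull hPush m k hk s hs0 hs).2 hks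

end Summit.HodgeConjecture.HodgeConjecture.Theorems.CancelByAnyClaimLattice.CosetRepresentative
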